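import Summits.RiemannHypothesis.RiemannHypothesis.Theorems.SuzukiFlowKernelPrimePart
import Summits.RiemannHypothesis.RiemannHypothesis.Theorems.SuzukiFlowKernelPolarPart
import Summits.RiemannHypothesis.RiemannHypothesis.Theorems.SuzukiFlowKernelDigammaPart
import Literature.NumberTheory.LFunctions.SmoothedExplicitFormulaPrimeSide

/-!
# The `θ`-flow generator made explicit: `J_θ = k ∗ K_θ` with the explicit-formula kernel `k` (column DBR; RH-FREE)

RH-FREE throughout; nothing here bears on the truth of RH.

Assembly of the three pieces (`Theorems.SuzukiFlowKernelPrimePart`, `…PolarPart`, `…DigammaPart`) of the flow kernel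
`J_θ(x) = Re (2π)⁻¹∫_{Im z=1} L(z)Θ_θ(z)e^{−izx}dz` (`Theorems.SuzukiKernelThetaDeriv.hasDerivAt_limKernel`,
`Theorems.SuzukiThetaFlowDefs.flowKernel`), `L(z) = −2ξ'/ξ(s)`, `s = ½ − iz`: on `Re s > 1` the tree's explicit formula
`ξ'/ξ(s) = 1/s + 1/(s−1) − ½log π + ½ψ(s/2) − L(Λ,s)` (`logDeriv_riemannXi_eq_of_one_lt_re`) splits the line integral into
five absolutely convergent pieces:

* `invFourierLine_flowSymbol_mul_limTheta_eq` — for `θ > 1`, real `x`: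
  `invFourierLine (L·Θ_θ) 1 x = −2·invFourierLine (Θ_θ/s) 1 x − 2·invFourierLine (Θ_θ/(s−1)) 1 x
      + log π · invFourierLine Θ_θ 1 x − invFourierLine (ψ(s/2)Θ_θ) 1 x + 2·invFourierLine (L(Λ,s)Θ_θ) 1 x`;
* **`invFourierLine_flowSymbol_mul_limTheta_explicit`** — the same with every piece on the `x`-side:
  `= −2∫𝟙_{v>0}e^{−v/2}K_θ(x−v)dv − 2∫𝟙_{v>0}e^{v/2}K_θ(x−v)dv + (log π + γ)·K_θ(x)`
  `  − Σ' k [K_θ(x)/(k+1) − 2∫𝟙_{v>0}e^{−(2k+½)v}K_θ(x−v)dv] + 2Σ' n Λ(n)n^{−1/2}K_θ(x − log n)`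
  (as complex numbers; `invFourierLine Θ_θ 1 = K_θ` by `ofReal_limKernel`), i.e. `J_θ = k ∗ K_θ` with
  `k = −2(e^{−x/2} + e^{x/2})𝟙_{x>0} + (log π + γ)δ₀ − Σ_k[δ₀/(k+1) − 2e^{−(2k+½)x}𝟙_{x>0}] + 2ΣΛ(n)n^{−1/2}δ_{log n}`
  — the causal explicit-formula distribution (polar, archimedean in Bombieri's form `e^{x/2}/sinh x = Σ_k 2e^{−(2k+½)x}`,
  prime), the `x`-side input of `FlowPairing`.

References: [Su20] M. Suzuki, ASPM 84 (2020) = arXiv:1907.07302, (1.9); E. Bombieri, Rend. Lincei (9) 11 (2000), Thm 2.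
-/

noncomputable section

-- D-0017: `Summit.<S>.<S>.…` is the designed namespace of a single-problem summit.
set_option linter.dupNamespace false

open Complex MeasureTheory Filter Topology Set LSeries
open scoped LSeries.notation ArithmeticFunction.vonMangoldt

namespace Summit.RiemannHypothesis.RiemannHypothesis.Theorems.SuzukiKernelSemigroup

open Literature.NumberTheory.LFunctions

/-! ## §1 Integrability of the five pieces along `Im z = 1` -/

/-- RH-FREE.  A bounded continuous multiplier keeps the line integrand integrable: if `‖m(u)‖ ≤ M` and `m` is continuous
then `u ↦ m(u)·(Θ_θ(u+i)·e^{−i(u+i)x})` is integrable (`θ > 1`). -/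
theorem integrable_mul_limTheta_lineIntegrand {θ : ℝ} (hθ : 1 < θ) (x : ℝ) {m : ℝ → ℂ} (hm : Continuous m)
    {M : ℝ} (hM : ∀ u, ‖m u‖ ≤ M) :
    Integrable fun u : ℝ => m u * (limTheta θ ((u : ℂ) + ((1 : ℝ) : ℂ) * I) *
      Complex.exp (-I * ((u : ℂ) + ((1 : ℝ) : ℂ) * I) * (x : ℂ))) := by
  have hI := integrable_limTheta_lineIntegrand hθ (b := 1) (by norm_num) x
  refine (hI.norm.const_mul M).mono' (hm.aestronglyMeasurable.mul hI.aestronglyMeasurable)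
    (Eventually.of_forall fun u => ?_)
  rw [norm_mul]
  exact mul_le_mul_of_nonneg_right (hM u) (norm_nonneg _)

/-- RH-FREE.  On `Im z = 1`, `s − c` (`c < 3/2` real) has real part `3/2 − c > 0`. -/
theorem re_half_sub_line_sub (c u : ℝ) :
    ((1 : ℂ) / 2 - I * ((u : ℂ) + ((1 : ℝ) : ℂ) * I) - (c : ℂ)).re = 3 / 2 - c := by
  rw [sub_re, half_sub_I_mul_line_one]; simp

/-- RH-FREE.  The polar multipliers `1/(s − c)`, `c < 3/2` real, are continuous along `Im z = 1`. -/
theorem continuous_inv_half_sub_line_sub (c : ℝ) (hc : c < 3 / 2) :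
    Continuous fun u : ℝ => 1 / ((1 : ℂ) / 2 - I * ((u : ℂ) + ((1 : ℝ) : ℂ) * I) - (c : ℂ)) := by
  refine continuous_const.div (by fun_prop) fun u h => ?_
  have := congrArg Complex.re h
  rw [re_half_sub_line_sub] at this
  simp at this
  linarith

/-- RH-FREE.  … and bounded by `1/(3/2 − c)` there. -/
theorem norm_inv_half_sub_line_sub_le (c : ℝ) (hc : c < 3 / 2) (u : ℝ) :
    ‖1 / ((1 : ℂ) / 2 - I * ((u : ℂ) + ((1 : ℝ) : ℂ) * I) - (c : ℂ))‖ ≤ 1 / (3 / 2 - c) := by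
  rw [norm_div, norm_one]
  apply one_div_le_one_div_of_le (by linarith)
  have h1 := Complex.abs_re_le_norm ((1 : ℂ) / 2 - I * ((u : ℂ) + ((1 : ℝ) : ℂ) * I) - (c : ℂ))
  rw [re_half_sub_line_sub, abs_of_pos (by linarith)] at h1
  exact h1

/-- RH-FREE.  The prime multiplier `L(Λ, s)` is continuous along `Im z = 1` (tree: `continuous_LSeries_vonMangoldt_vertical`). -/
theorem continuous_LSeries_vonMangoldt_line :
    Continuous fun u : ℝ => L ↗Λ ((1 : ℂ) / 2 - I * ((u : ℂ) + ((1 : ℝ) : ℂ) * I)) := by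
  have h := (continuous_LSeries_vonMangoldt_vertical (α := 3 / 2) (by norm_num)).comp continuous_neg
  refine h.congr fun u => ?_
  simp only [Function.comp_apply]
  rw [half_sub_I_mul_line_one]

/-- RH-FREE.  `‖L(Λ, s)‖ ≤ Σ Λ(n) n^{−3/2}` along `Im z = 1` (tree: `norm_LSeries_vonMangoldt_vertical_le`). -/
theorem norm_LSeries_vonMangoldt_line_le (u : ℝ) :
    ‖L ↗Λ ((1 : ℂ) / 2 - I * ((u : ℂ) + ((1 : ℝ) : ℂ) * I))‖ ≤
      ∑' n : ℕ, ‖term (fun n => ((Λ n : ℝ) : ℂ)) ((3 / 2 : ℝ) : ℂ) n‖ := by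
  rw [half_sub_I_mul_line_one]
  exact norm_LSeries_vonMangoldt_vertical_le (α := 3 / 2) (by norm_num) (-u)

/-! ## §2 The generator on `Re s > 1` and the five-piece split -/

/-- RH-FREE.  The explicit formula for the generator: for `Re s > 1`,
`−2ξ'/ξ(s) = −2/s − 2/(s−1) + log π − ψ(s/2) + 2L(Λ,s)`. -/
theorem flowSymbol_eq {s : ℂ} (hre : 1 < s.re) :
    -2 * logDeriv riemannXi s =
      -2 * (1 / s) + (-2) * (1 / (s - 1)) + (Real.log Real.pi : ℂ) + (-1) * digamma (s / 2) + 2 * L ↗Λ s := by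
  rw [logDeriv_riemannXi_eq_of_one_lt_re hre]
  ring

/-- **RH-FREE · the five-piece split of the flow transform**: for `θ > 1` and real `x`,
`invFourierLine (L·Θ_θ) 1 x = −2·invFourierLine (Θ_θ/s) 1 x − 2·invFourierLine (Θ_θ/(s−1)) 1 x
  + log π · invFourierLine Θ_θ 1 x − invFourierLine (ψ(s/2)·Θ_θ) 1 x + 2·invFourierLine (L(Λ,s)·Θ_θ) 1 x`,
`s = ½ − iz`. -/
theorem invFourierLine_flowSymbol_mul_limTheta_eq {θ : ℝ} (hθ : 1 < θ) (x : ℝ) :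
    invFourierLine (fun z : ℂ => -2 * logDeriv riemannXi (1 / 2 - I * z) * limTheta θ z) 1 x =
      -2 * invFourierLine (fun z : ℂ => limTheta θ z / (1 / 2 - I * z)) 1 x +
      (-2) * invFourierLine (fun z : ℂ => limTheta θ z / (1 / 2 - I * z - 1)) 1 x +
      (Real.log Real.pi : ℂ) * invFourierLine (limTheta θ) 1 x +
      (-1) * invFourierLine (fun z : ℂ => digamma ((1 / 2 - I * z) / 2) * limTheta θ z) 1 x +
      2 * invFourierLine (fun z : ℂ => L ↗Λ (1 / 2 - I * z) * limTheta θ z) 1 x := by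
  have hΘE_int := integrable_limTheta_lineIntegrand hθ (b := 1) (by norm_num) x
  -- integrability of the five pieces, in the shape produced by unfolding `invFourierLine`
  have h1 : Integrable fun u : ℝ => -2 * (limTheta θ ((u : ℂ) + ((1 : ℝ) : ℂ) * I) /
      (1 / 2 - I * ((u : ℂ) + ((1 : ℝ) : ℂ) * I)) * Complex.exp (-I * ((u : ℂ) + ((1 : ℝ) : ℂ) * I) * (x : ℂ))) := by
    have h := (integrable_mul_limTheta_lineIntegrand hθ x (continuous_inv_half_sub_line_sub 0 (by norm_num))
      (norm_inv_half_sub_line_sub_le 0 (by norm_num))).const_mul (-2 : ℂ)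
    refine h.congr (Eventually.of_forall fun u => ?_)
    push_cast
    ring
  have h2 : Integrable fun u : ℝ => -2 * (limTheta θ ((u : ℂ) + ((1 : ℝ) : ℂ) * I) /
      (1 / 2 - I * ((u : ℂ) + ((1 : ℝ) : ℂ) * I) - 1) * Complex.exp (-I * ((u : ℂ) + ((1 : ℝ) : ℂ) * I) * (x : ℂ))) := by
    have h := (integrable_mul_limTheta_lineIntegrand hθ x (continuous_inv_half_sub_line_sub 1 (by norm_num))
      (norm_inv_half_sub_line_sub_le 1 (by norm_num))).const_mul (-2 : ℂ)
    refine h.congr (Eventually.of_forall fun u => ?_)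
    push_cast
    ring
  have h3 : Integrable fun u : ℝ => (Real.log Real.pi : ℂ) * (limTheta θ ((u : ℂ) + ((1 : ℝ) : ℂ) * I) *
      Complex.exp (-I * ((u : ℂ) + ((1 : ℝ) : ℂ) * I) * (x : ℂ))) := hΘE_int.const_mul _
  have h4 : Integrable fun u : ℝ => -1 * (digamma ((1 / 2 - I * ((u : ℂ) + ((1 : ℝ) : ℂ) * I)) / 2) *
      limTheta θ ((u : ℂ) + ((1 : ℝ) : ℂ) * I) * Complex.exp (-I * ((u : ℂ) + ((1 : ℝ) : ℂ) * I) * (x : ℂ))) :=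
    (integrable_digamma_mul_limTheta_lineIntegrand hθ x).const_mul _
  have h5 : Integrable fun u : ℝ => 2 * (L ↗Λ (1 / 2 - I * ((u : ℂ) + ((1 : ℝ) : ℂ) * I)) *
      limTheta θ ((u : ℂ) + ((1 : ℝ) : ℂ) * I) * Complex.exp (-I * ((u : ℂ) + ((1 : ℝ) : ℂ) * I) * (x : ℂ))) := by
    have h := (integrable_mul_limTheta_lineIntegrand hθ x continuous_LSeries_vonMangoldt_line
      norm_LSeries_vonMangoldt_line_le).const_mul (2 : ℂ)
    refine h.congr (Eventually.of_forall fun u => ?_)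
    simp only
    ring
  -- pointwise split of the integrand
  have hsplit : (fun u : ℝ => -2 * logDeriv riemannXi (1 / 2 - I * ((u : ℂ) + ((1 : ℝ) : ℂ) * I)) *
      limTheta θ ((u : ℂ) + ((1 : ℝ) : ℂ) * I) * Complex.exp (-I * ((u : ℂ) + ((1 : ℝ) : ℂ) * I) * (x : ℂ))) =
      fun u : ℝ =>
        -2 * (limTheta θ ((u : ℂ) + ((1 : ℝ) : ℂ) * I) / (1 / 2 - I * ((u : ℂ) + ((1 : ℝ) : ℂ) * I)) *
          Complex.exp (-I * ((u : ℂ) + ((1 : ℝ) : ℂ) * I) * (x : ℂ))) +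
        -2 * (limTheta θ ((u : ℂ) + ((1 : ℝ) : ℂ) * I) / (1 / 2 - I * ((u : ℂ) + ((1 : ℝ) : ℂ) * I) - 1) *
          Complex.exp (-I * ((u : ℂ) + ((1 : ℝ) : ℂ) * I) * (x : ℂ))) +
        (Real.log Real.pi : ℂ) * (limTheta θ ((u : ℂ) + ((1 : ℝ) : ℂ) * I) *
          Complex.exp (-I * ((u : ℂ) + ((1 : ℝ) : ℂ) * I) * (x : ℂ))) +
        -1 * (digamma ((1 / 2 - I * ((u : ℂ) + ((1 : ℝ) : ℂ) * I)) / 2) *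
          limTheta θ ((u : ℂ) + ((1 : ℝ) : ℂ) * I) * Complex.exp (-I * ((u : ℂ) + ((1 : ℝ) : ℂ) * I) * (x : ℂ))) +
        2 * (L ↗Λ (1 / 2 - I * ((u : ℂ) + ((1 : ℝ) : ℂ) * I)) *
          limTheta θ ((u : ℂ) + ((1 : ℝ) : ℂ) * I) * Complex.exp (-I * ((u : ℂ) + ((1 : ℝ) : ℂ) * I) * (x : ℂ))) := by
    funext u
    have hre : 1 < ((1 : ℂ) / 2 - I * ((u : ℂ) + ((1 : ℝ) : ℂ) * I)).re := by
      rw [half_sub_I_mul_line_one]; simp; norm_num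
    rw [flowSymbol_eq hre]
    ring
  unfold invFourierLine
  beta_reduce
  rw [hsplit, integral_add, integral_add, integral_add, integral_add, integral_const_mul, integral_const_mul,
    integral_const_mul, integral_const_mul, integral_const_mul]
  · ring
  · exact h1
  · exact h2
  · exact h1.add h2
  · exact h3
  · exact (h1.add h2).add h3
  · exact h4
  · exact ((h1.add h2).add h3).add h4
  · exact h5

/-! ## §3 The flow generator is convolution with the explicit-formula kernel -/

/-- **RH-FREE · `J_θ = k ∗ K_θ` EXPLICITLY**: for `θ > 1` and real `x`, the flow transform
`invFourierLine (L·Θ_θ) 1 x` (whose real part is `∂_θ K_θ(x)`, `hasDerivAt_limKernel`) equals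
`−2∫𝟙_{v>0}e^{−v/2}K_θ(x−v)dv − 2∫𝟙_{v>0}e^{v/2}K_θ(x−v)dv + log π·K_θ(x)`
`− (−γ·K_θ(x) + Σ' k [K_θ(x)/(k+1) − 2∫𝟙_{v>0}e^{−(2k+½)v}K_θ(x−v)dv]) + 2Σ' n Λ(n)n^{−1/2}K_θ(x − log n)`
(as complex numbers): the causal explicit-formula distribution
`k = −2(e^{−x/2} + e^{x/2})𝟙_{x>0} + (log π + γ)δ₀ − Σ_k[δ₀/(k+1) − 2e^{−(2k+½)x}𝟙_{x>0}] + 2ΣΛ(n)n^{−1/2}δ_{log n}`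
convolved with `K_θ`.  Nothing here bears on RH. -/
theorem invFourierLine_flowSymbol_mul_limTheta_explicit {θ : ℝ} (hθ : 1 < θ) (x : ℝ) :
    invFourierLine (fun z : ℂ => -2 * logDeriv riemannXi (1 / 2 - I * z) * limTheta θ z) 1 x =
      -2 * (∫ v : ℝ, (((Ioi (0 : ℝ)).indicator (fun v : ℝ => Real.exp (-(1 / 2) * v)) v : ℝ) : ℂ) *
        (limKernel θ (x - v) : ℂ)) +
      (-2) * (∫ v : ℝ, (((Ioi (0 : ℝ)).indicator (fun v : ℝ => Real.exp (1 / 2 * v)) v : ℝ) : ℂ) *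
        (limKernel θ (x - v) : ℂ)) +
      (Real.log Real.pi : ℂ) * (limKernel θ x : ℂ) +
      (-1) * (-(Real.eulerMascheroniConstant : ℂ) * (limKernel θ x : ℂ) +
        ∑' k : ℕ, (1 / ((k : ℂ) + 1) * (limKernel θ x : ℂ) -
          2 * ∫ v : ℝ, (((Ioi (0 : ℝ)).indicator (fun v : ℝ => Real.exp ((-2 * (k : ℝ) - 1 / 2) * v)) v : ℝ) : ℂ) *
            (limKernel θ (x - v) : ℂ))) +
      2 * ∑' n : ℕ, ((ArithmeticFunction.vonMangoldt n : ℝ) : ℂ) * ((n : ℂ) ^ (-(1 / 2 : ℂ))) *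
        (limKernel θ (x - Real.log n) : ℂ) := by
  -- the two polar pieces in the shape of `invFourierLine_inv_sub_mul_limTheta`
  have eP1 : (fun z : ℂ => limTheta θ z / (1 / 2 - I * z)) =
      fun z : ℂ => limTheta θ z / ((1 / 2 - I * z) - (1 / 2 + (((-(1 / 2) : ℝ)) : ℂ))) := by
    funext z; congr 1; push_cast; ring
  have eP2 : (fun z : ℂ => limTheta θ z / (1 / 2 - I * z - 1)) =
      fun z : ℂ => limTheta θ z / ((1 / 2 - I * z) - (1 / 2 + (((1 / 2 : ℝ)) : ℂ))) := by
    funext z; congr 1; push_cast; ring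
  have hP1 := invFourierLine_inv_sub_mul_limTheta hθ (a := -(1 / 2)) (by norm_num) x
  have hP2 := invFourierLine_inv_sub_mul_limTheta hθ (a := 1 / 2) (by norm_num) x
  -- the digamma series, termwise through the polar lemma with `a = −2k − ½`
  have hD : (∑' k : ℕ, (1 / ((k : ℂ) + 1) * invFourierLine (limTheta θ) 1 x -
      2 * invFourierLine (fun z : ℂ => limTheta θ z / ((1 / 2 - I * z) + 2 * (k : ℂ))) 1 x)) =
      ∑' k : ℕ, (1 / ((k : ℂ) + 1) * (limKernel θ x : ℂ) -
        2 * ∫ v : ℝ, (((Ioi (0 : ℝ)).indicator (fun v : ℝ => Real.exp ((-2 * (k : ℝ) - 1 / 2) * v)) v : ℝ) : ℂ) *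
          (limKernel θ (x - v) : ℂ)) := by
    refine tsum_congr fun k => ?_
    have e : (fun z : ℂ => limTheta θ z / (1 / 2 - I * z + 2 * (k : ℂ))) =
        fun z : ℂ => limTheta θ z / ((1 / 2 - I * z) - (1 / 2 + (((-2 * (k : ℝ) - 1 / 2 : ℝ)) : ℂ))) := by
      funext z; congr 1; push_cast; ring
    rw [e, invFourierLine_inv_sub_mul_limTheta hθ (a := -2 * (k : ℝ) - 1 / 2)
      (by have := (Nat.cast_nonneg k : (0 : ℝ) ≤ k); linarith) x, ofReal_limKernel]
  -- the prime series
  have hP : (∑' n : ℕ, ((ArithmeticFunction.vonMangoldt n : ℝ) : ℂ) * ((n : ℂ) ^ (-(1 / 2 : ℂ))) *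
      invFourierLine (limTheta θ) 1 (x - Real.log n)) =
      ∑' n : ℕ, ((ArithmeticFunction.vonMangoldt n : ℝ) : ℂ) * ((n : ℂ) ^ (-(1 / 2 : ℂ))) *
        (limKernel θ (x - Real.log n) : ℂ) := by
    refine tsum_congr fun n => ?_
    rw [ofReal_limKernel]
  rw [invFourierLine_flowSymbol_mul_limTheta_eq hθ x, eP1, hP1, eP2, hP2, invFourierLine_digamma_mul_limTheta hθ x,
    hD, invFourierLine_vonMangoldt_mul_limTheta hθ x, hP, ofReal_limKernel]

end Summit.RiemannHypothesis.RiemannHypothesis.Theorems.SuzukiKernelSemigroup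

end
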